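import Literature.Analysis.FunctionSpaces.BesselIIntegralSeries
import HarnessLib

/-!
# The SHARP two-sided Turán inequality for the modified Bessel functions of integer order:
# `(n+1)/(n+2) · I_{n+1}(x)² < I_n(x) I_{n+2}(x) < I_{n+1}(x)²` for `x ≠ 0`

Topic `Literature/Analysis/FunctionSpaces`, a proofs sibling of `BesselIIntegralSeries.lean` (which
transports the NON-strict Turán inequality `I_n I_{n+2} ≤ I_{n+1}²` of
`Literature.Probability.LatticeModels.besselI_mul_besselI_add_two_le_sq` to the integral-defined
`besselI`).  Source read: Á. Baricz, *Turán type inequalities for modified Bessel functions*,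
Bull. Aust. Math. Soc. 82 (2010) 254–264 (`lit read doi:10.1017/s000497271000002x`, §2):
**Theorem 2.1** — for all `ν > −1` and real `u` the Turán-type inequalities
`0 ≤ I_ν(u)² − I_{ν−1}(u) I_{ν+1}(u) ≤ I_ν(u)²/(ν+1)` hold, "in each of these inequalities equality
holds if and only if `u = 0`", and the constants `0` and `1/(ν+1)` are best possible; the left-hand
side is Thiruvenkatachar–Nanjundiah (1951), the right-hand side Joshi–Bissu (1991).  Here: integer
orders `ν = n + 1`, `n ∈ ℕ`, proved ELEMENTARILY from the tree's product formula
`I_m I_n = Σ_k (x/2)^{2k+m+n} C(2k+m+n,k)/((k+m)!(k+n)!)`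
(`Literature.Probability.LatticeModels.besselI_mul_besselI`, Cauchy product + Vandermonde): with
`t_k := (x/2)^{2(k+n+1)} C(2(k+n+1),k)/((k+n+1)!(k+n+2)!) ≥ 0` one has, term by term,
`[I_n I_{n+2}]_k = (k+n+1)·t_k` and `[I_{n+1}²]_k = (k+n+2)·t_k`, hence

* `hasSum_besselI_sq_sub_mul` — **`I_{n+1}² − I_n I_{n+2} = Σ_k t_k`** (Joshi–Bissu's explicit
  Turánian), every term `≥ 0`, the `k = 0` term `> 0` for `x ≠ 0`;
* `besselI_mul_besselI_add_two_lt_sq` — **`I_n(x) I_{n+2}(x) < I_{n+1}(x)²` for `x ≠ 0`** (strict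
  Turán; the tree had `≤`);
* `mul_besselI_succ_sq_le` / `mul_besselI_succ_sq_lt` — **`(n+1)·I_{n+1}(x)² ≤ (n+2)·I_n(x) I_{n+2}(x)`**
  for every real `x`, strict for `x ≠ 0` (the right-hand side of Baricz's Theorem 2.1, i.e.
  `I_{n+1}² − I_n I_{n+2} ≤ I_{n+1}²/(n+2)`: termwise `(n+2)·t_k ≤ (k+n+2)·t_k`);
* `besselI_mul_besselI_div_sq_mem_Ioo` — for `x > 0` the Turán quotient
  `I_n(x) I_{n+2}(x) / I_{n+1}(x)²` lies in the OPEN interval `((n+1)/(n+2), 1)`; at `n = 1`: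
  `2/3 < I₁(x)I₃(x)/I₂(x)² < 1` (`besselI_one_mul_three_div_two_sq_mem_Ioo`), the form used by the
  lattice-gauge venture files (`u = I₂/I₁`, adjoint ratio `I₃/I₁`: `(2/3)u² < I₃/I₁ < u²`).

All statements are given for BOTH copies of the function in the tree: the series-defined
`Literature.Probability.LatticeModels.besselI (m : ℤ)` (§1, where the termwise work is done) and the
integral-defined `Literature.Analysis.FunctionSpaces.besselI (n : ℕ)` (§2, by
`besselI_eq_latticeModels_besselI`).  Everything is proved; no definition, no named fact.
NOT here: non-integer order `ν` (Baricz's theorem is for all real `ν > −1`); sharpness of the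
constants as `x → ∞`; the companion inequalities for `K_ν` (Baricz §3).

## References

* Á. Baricz, *Turán type inequalities for modified Bessel functions*, Bull. Aust. Math. Soc. 82
  (2010) 254–264, doi:10.1017/S000497271000002X — Theorem 2.1 (2.1). [Baricz2010TuranBessel]
* V. R. Thiruvenkatachar, T. S. Nanjundiah, Proc. Indian Acad. Sci. Sect. A 33 (1951) 373–384
  (left inequality). [ThiruvenkatacharNanjundiah1951]
* C. M. Joshi, S. K. Bissu, *Some inequalities of Bessel and modified Bessel functions*,
  J. Austral. Math. Soc. Ser. A 50 (1991) 333–342 (right inequality, explicit Turánian; cited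
  through Baricz 2010, ref. [17]).
* NIST DLMF §10.31.3 (product formula). [DLMF]
-/

noncomputable section

open Finset
open scoped BigOperators Nat

namespace Literature.Analysis.FunctionSpaces

/-! ### 1. Series level: `Literature.Probability.LatticeModels.besselI` (integer order) -/

section SeriesLevel

/-- `HasSum` form of the tree's product formula
`I_m(x) I_n(x) = Σ_k (x/2)^{2k+m+n} C(2k+m+n,k)/((k+m)!(k+n)!)`. [cite: DLMF, 10.31.3] -/
theorem hasSum_latticeModels_besselI_mul_besselI (m n : ℕ) (x : ℝ) :
    HasSum (fun k : ℕ => (x / 2) ^ (2 * k + m + n) * (((2 * k + m + n).choose k : ℕ) : ℝ) /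
        (((k + m)! : ℝ) * ((k + n)! : ℝ)))
      (Probability.LatticeModels.besselI (m : ℤ) x * Probability.LatticeModels.besselI (n : ℤ) x) := by
  rw [Probability.LatticeModels.besselI_mul_besselI]
  exact (Probability.LatticeModels.summable_besselIProdTerm m n x).hasSum

/-- The Turán term `t_k = (x/2)^{2(k+n+1)} C(2(k+n+1),k)/((k+n+1)!(k+n+2)!)` is non-negative (even
power). [cite: Baricz2010TuranBessel, Theorem 2.1 (proof, explicit Turánian of Joshi–Bissu)] -/
theorem turanTerm_nonneg (n : ℕ) (x : ℝ) (k : ℕ) :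
    0 ≤ (x / 2) ^ (2 * (k + n + 1)) * (((2 * (k + n + 1)).choose k : ℕ) : ℝ) /
        (((k + n + 1)! : ℝ) * ((k + n + 2)! : ℝ)) := by
  have h : 0 ≤ (x / 2) ^ (2 * (k + n + 1)) := by rw [pow_mul]; positivity
  positivity

/-- For `x ≠ 0` every Turán term is strictly positive as soon as its binomial coefficient is, in
particular the terms `k = 0` and `k = 1`. [cite: Baricz2010TuranBessel, Theorem 2.1 (equality iff u = 0)] -/
theorem turanTerm_pos (n : ℕ) {x : ℝ} (hx : x ≠ 0) (k : ℕ) :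
    0 < (x / 2) ^ (2 * (k + n + 1)) * (((2 * (k + n + 1)).choose k : ℕ) : ℝ) /
        (((k + n + 1)! : ℝ) * ((k + n + 2)! : ℝ)) := by
  have hx2 : 0 < (x / 2) ^ 2 := by positivity
  have h : 0 < (x / 2) ^ (2 * (k + n + 1)) := by rw [pow_mul]; exact pow_pos hx2 _
  have hc : 0 < (((2 * (k + n + 1)).choose k : ℕ) : ℝ) := by
    exact_mod_cast Nat.choose_pos (by omega)
  positivity

/-- Termwise factorisation of the product series of `I_n I_{n+2}`:
`[I_n I_{n+2}]_k = (k+n+1) · t_k`. [cite: Baricz2010TuranBessel, Theorem 2.1 (proof)] -/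
theorem prodTerm_add_two_eq (n : ℕ) (x : ℝ) (k : ℕ) :
    (x / 2) ^ (2 * k + n + (n + 2)) * (((2 * k + n + (n + 2)).choose k : ℕ) : ℝ) /
        (((k + n)! : ℝ) * ((k + (n + 2))! : ℝ)) =
      ((k : ℝ) + n + 1) * ((x / 2) ^ (2 * (k + n + 1)) * (((2 * (k + n + 1)).choose k : ℕ) : ℝ) /
        (((k + n + 1)! : ℝ) * ((k + n + 2)! : ℝ))) := by
  have e1 : 2 * k + n + (n + 2) = 2 * (k + n + 1) := by ring
  have e2 : k + (n + 2) = (k + n + 1) + 1 := by ring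
  have e3 : k + n + 2 = (k + n + 1) + 1 := by ring
  have e4 : k + n + 1 = (k + n) + 1 := by ring
  rw [e1, e2, e3, e4]
  simp only [Nat.factorial_succ, Nat.cast_mul, Nat.cast_add, Nat.cast_one]
  have hF : (0 : ℝ) < ((k + n)! : ℝ) := by positivity
  field_simp

/-- Termwise factorisation of the product series of `I_{n+1}²`:
`[I_{n+1} I_{n+1}]_k = (k+n+2) · t_k`. [cite: Baricz2010TuranBessel, Theorem 2.1 (proof)] -/
theorem prodTerm_succ_succ_eq (n : ℕ) (x : ℝ) (k : ℕ) :
    (x / 2) ^ (2 * k + (n + 1) + (n + 1)) * (((2 * k + (n + 1) + (n + 1)).choose k : ℕ) : ℝ) /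
        (((k + (n + 1))! : ℝ) * ((k + (n + 1))! : ℝ)) =
      ((k : ℝ) + n + 2) * ((x / 2) ^ (2 * (k + n + 1)) * (((2 * (k + n + 1)).choose k : ℕ) : ℝ) /
        (((k + n + 1)! : ℝ) * ((k + n + 2)! : ℝ))) := by
  have e1 : 2 * k + (n + 1) + (n + 1) = 2 * (k + n + 1) := by ring
  have e2 : k + (n + 1) = k + n + 1 := by ring
  have e3 : k + n + 2 = (k + n + 1) + 1 := by ring
  rw [e1, e2, e3]
  simp only [Nat.factorial_succ, Nat.cast_mul, Nat.cast_add, Nat.cast_one]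
  have hF : (0 : ℝ) < ((k + n + 1)! : ℝ) := by positivity
  field_simp
  ring

/-- **The explicit Turánian** (Joshi–Bissu): `I_{n+1}(x)² − I_n(x) I_{n+2}(x) = Σ_k t_k` with
`t_k = (x/2)^{2(k+n+1)} C(2(k+n+1),k)/((k+n+1)!(k+n+2)!) ≥ 0`, for the series-defined `I`.
[cite: Baricz2010TuranBessel, Theorem 2.1 (proof: (2.2) and the termwise representation of ref. [17])] -/
theorem hasSum_latticeModels_besselI_sq_sub_mul (n : ℕ) (x : ℝ) :
    HasSum (fun k : ℕ => (x / 2) ^ (2 * (k + n + 1)) * (((2 * (k + n + 1)).choose k : ℕ) : ℝ) /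
        (((k + n + 1)! : ℝ) * ((k + n + 2)! : ℝ)))
      (Probability.LatticeModels.besselI ((n + 1 : ℕ) : ℤ) x ^ 2 -
        Probability.LatticeModels.besselI (n : ℤ) x * Probability.LatticeModels.besselI ((n + 2 : ℕ) : ℤ) x) := by
  have h1 := hasSum_latticeModels_besselI_mul_besselI (n + 1) (n + 1) x
  have h2 := hasSum_latticeModels_besselI_mul_besselI n (n + 2) x
  rw [← sq] at h1
  refine (h1.sub h2).congr_fun fun k => ?_
  rw [prodTerm_succ_succ_eq, prodTerm_add_two_eq]
  ring

/-- **Strict Turán inequality** for the series-defined `I_m`: `I_n(x) I_{n+2}(x) < I_{n+1}(x)²` for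
`x ≠ 0` (the `k = 0` Turán term is `> 0`). [cite: Baricz2010TuranBessel, Theorem 2.1 (left inequality, equality iff u = 0)] -/
theorem latticeModels_besselI_mul_besselI_add_two_lt_sq (n : ℕ) {x : ℝ} (hx : x ≠ 0) :
    Probability.LatticeModels.besselI (n : ℤ) x * Probability.LatticeModels.besselI ((n + 2 : ℕ) : ℤ) x <
      Probability.LatticeModels.besselI ((n + 1 : ℕ) : ℤ) x ^ 2 := by
  have h := hasSum_latticeModels_besselI_sq_sub_mul n x
  have hpos : 0 < Probability.LatticeModels.besselI ((n + 1 : ℕ) : ℤ) x ^ 2 -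
      Probability.LatticeModels.besselI (n : ℤ) x *
        Probability.LatticeModels.besselI ((n + 2 : ℕ) : ℤ) x := by
    rw [← h.tsum_eq]
    exact h.summable.tsum_pos (turanTerm_nonneg n x) 0 (turanTerm_pos n hx 0)
  linarith

/-- **Right-hand Turán bound** for the series-defined `I_m`, all real `x`:
`(n+1)·I_{n+1}(x)² ≤ (n+2)·I_n(x) I_{n+2}(x)`, i.e. `I_{n+1}² − I_n I_{n+2} ≤ I_{n+1}²/(n+2)`
(termwise: `(n+2)·t_k ≤ (k+n+2)·t_k`). [cite: Baricz2010TuranBessel, Theorem 2.1 (right inequality, β_ν = 1/(ν+1))] -/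
theorem latticeModels_mul_besselI_succ_sq_le (n : ℕ) (x : ℝ) :
    ((n : ℝ) + 1) * Probability.LatticeModels.besselI ((n + 1 : ℕ) : ℤ) x ^ 2 ≤
      ((n : ℝ) + 2) * (Probability.LatticeModels.besselI (n : ℤ) x *
        Probability.LatticeModels.besselI ((n + 2 : ℕ) : ℤ) x) := by
  have hD := hasSum_latticeModels_besselI_sq_sub_mul n x
  have hS := hasSum_latticeModels_besselI_mul_besselI (n + 1) (n + 1) x
  rw [← sq] at hS
  -- `(n+2)·(I² − I I) ≤ I²` termwise
  have hle : ((n : ℝ) + 2) * (Probability.LatticeModels.besselI ((n + 1 : ℕ) : ℤ) x ^ 2 -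
      Probability.LatticeModels.besselI (n : ℤ) x *
        Probability.LatticeModels.besselI ((n + 2 : ℕ) : ℤ) x) ≤
      Probability.LatticeModels.besselI ((n + 1 : ℕ) : ℤ) x ^ 2 := by
    refine hasSum_le (fun k => ?_) (hD.mul_left ((n : ℝ) + 2)) hS
    rw [prodTerm_succ_succ_eq]
    exact mul_le_mul_of_nonneg_right (by
      have : (0 : ℝ) ≤ k := Nat.cast_nonneg k
      linarith) (turanTerm_nonneg n x k)
  linarith

/-- Strict right-hand Turán bound for the series-defined `I_m`, `x ≠ 0`:
`(n+1)·I_{n+1}(x)² < (n+2)·I_n(x) I_{n+2}(x)` (the `k = 1` terms differ strictly).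
[cite: Baricz2010TuranBessel, Theorem 2.1 (right inequality, equality iff u = 0)] -/
theorem latticeModels_mul_besselI_succ_sq_lt (n : ℕ) {x : ℝ} (hx : x ≠ 0) :
    ((n : ℝ) + 1) * Probability.LatticeModels.besselI ((n + 1 : ℕ) : ℤ) x ^ 2 <
      ((n : ℝ) + 2) * (Probability.LatticeModels.besselI (n : ℤ) x *
        Probability.LatticeModels.besselI ((n + 2 : ℕ) : ℤ) x) := by
  have hD := hasSum_latticeModels_besselI_sq_sub_mul n x
  have hS := hasSum_latticeModels_besselI_mul_besselI (n + 1) (n + 1) x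
  rw [← sq] at hS
  have hlt : ((n : ℝ) + 2) * (Probability.LatticeModels.besselI ((n + 1 : ℕ) : ℤ) x ^ 2 -
      Probability.LatticeModels.besselI (n : ℤ) x *
        Probability.LatticeModels.besselI ((n + 2 : ℕ) : ℤ) x) <
      Probability.LatticeModels.besselI ((n + 1 : ℕ) : ℤ) x ^ 2 := by
    refine hasSum_lt (f := fun k : ℕ => ((n : ℝ) + 2) * ((x / 2) ^ (2 * (k + n + 1)) *
        (((2 * (k + n + 1)).choose k : ℕ) : ℝ) / (((k + n + 1)! : ℝ) * ((k + n + 2)! : ℝ))))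
      (i := 1) (fun k => ?_) ?_ (hD.mul_left ((n : ℝ) + 2)) hS
    · show _ ≤ _
      rw [prodTerm_succ_succ_eq]
      exact mul_le_mul_of_nonneg_right (by
        have : (0 : ℝ) ≤ k := Nat.cast_nonneg k
        linarith) (turanTerm_nonneg n x k)
    · show _ < _
      rw [prodTerm_succ_succ_eq]
      exact mul_lt_mul_of_pos_right (by push_cast; linarith) (turanTerm_pos n hx 1)
  linarith

end SeriesLevel

/-! ### 2. The integral-defined `besselI` of `BesselMoments.lean` -/

/-- **The explicit Turánian**: `I_{n+1}(x)² − I_n(x) I_{n+2}(x) = Σ_k (x/2)^{2(k+n+1)} C(2(k+n+1),k)/((k+n+1)!(k+n+2)!)`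
for the integral-defined `I_n`. [cite: Baricz2010TuranBessel, Theorem 2.1 (proof)] -/
theorem hasSum_besselI_sq_sub_mul (n : ℕ) (x : ℝ) :
    HasSum (fun k : ℕ => (x / 2) ^ (2 * (k + n + 1)) * (((2 * (k + n + 1)).choose k : ℕ) : ℝ) /
        (((k + n + 1)! : ℝ) * ((k + n + 2)! : ℝ)))
      (besselI (n + 1) x ^ 2 - besselI n x * besselI (n + 2) x) := by
  rw [besselI_eq_latticeModels_besselI, besselI_eq_latticeModels_besselI n,
    besselI_eq_latticeModels_besselI (n + 2)]
  exact hasSum_latticeModels_besselI_sq_sub_mul n x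

/-- **Strict Turán inequality** `I_n(x)·I_{n+2}(x) < I_{n+1}(x)²` for `x ≠ 0` and every order
`n ∈ ℕ` (Thiruvenkatachar–Nanjundiah 1951 with Baricz's equality clause).
[cite: Baricz2010TuranBessel, Theorem 2.1 (left inequality, equality iff u = 0)] -/
theorem besselI_mul_besselI_add_two_lt_sq (n : ℕ) {x : ℝ} (hx : x ≠ 0) :
    besselI n x * besselI (n + 2) x < besselI (n + 1) x ^ 2 := by
  rw [besselI_eq_latticeModels_besselI, besselI_eq_latticeModels_besselI,
    besselI_eq_latticeModels_besselI]
  exact latticeModels_besselI_mul_besselI_add_two_lt_sq n hx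

/-- **Right-hand Turán bound**, all real `x`: `(n+1)·I_{n+1}(x)² ≤ (n+2)·I_n(x)·I_{n+2}(x)`
(equivalently `I_{n+1}² − I_n I_{n+2} ≤ I_{n+1}²/(n+2)`; Joshi–Bissu 1991, Baricz 2010).
[cite: Baricz2010TuranBessel, Theorem 2.1 (right inequality, β_ν = 1/(ν+1))] -/
theorem mul_besselI_succ_sq_le (n : ℕ) (x : ℝ) :
    ((n : ℝ) + 1) * besselI (n + 1) x ^ 2 ≤ ((n : ℝ) + 2) * (besselI n x * besselI (n + 2) x) := by
  rw [besselI_eq_latticeModels_besselI, besselI_eq_latticeModels_besselI n,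
    besselI_eq_latticeModels_besselI (n + 2)]
  exact latticeModels_mul_besselI_succ_sq_le n x

/-- **Strict right-hand Turán bound**, `x ≠ 0`: `(n+1)·I_{n+1}(x)² < (n+2)·I_n(x)·I_{n+2}(x)`.
[cite: Baricz2010TuranBessel, Theorem 2.1 (right inequality, equality iff u = 0)] -/
theorem mul_besselI_succ_sq_lt (n : ℕ) {x : ℝ} (hx : x ≠ 0) :
    ((n : ℝ) + 1) * besselI (n + 1) x ^ 2 < ((n : ℝ) + 2) * (besselI n x * besselI (n + 2) x) := by
  rw [besselI_eq_latticeModels_besselI, besselI_eq_latticeModels_besselI n,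
    besselI_eq_latticeModels_besselI (n + 2)]
  exact latticeModels_mul_besselI_succ_sq_lt n hx

/-- The difference form of the right-hand bound: `I_{n+1}(x)² − I_n(x) I_{n+2}(x) ≤ I_{n+1}(x)²/(n+2)`.
[cite: Baricz2010TuranBessel, Theorem 2.1 (2.1), right inequality] -/
theorem besselI_sq_sub_mul_le_sq_div (n : ℕ) (x : ℝ) :
    besselI (n + 1) x ^ 2 - besselI n x * besselI (n + 2) x ≤ besselI (n + 1) x ^ 2 / ((n : ℝ) + 2) := by
  have h := mul_besselI_succ_sq_le n x
  rw [le_div_iff₀ (by positivity)]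
  nlinarith [h]

/-- **The two-sided Turán quotient**: for `x > 0` and every `n ∈ ℕ`,
`(n+1)/(n+2) < I_n(x) I_{n+2}(x) / I_{n+1}(x)² < 1`. [cite: Baricz2010TuranBessel, Theorem 2.1 (2.1) with the equality clause] -/
theorem besselI_mul_besselI_div_sq_mem_Ioo (n : ℕ) {x : ℝ} (hx : 0 < x) :
    besselI n x * besselI (n + 2) x / besselI (n + 1) x ^ 2 ∈
      Set.Ioo (((n : ℝ) + 1) / ((n : ℝ) + 2)) 1 := by
  have hI : 0 < besselI (n + 1) x := by
    rw [besselI_eq_latticeModels_besselI]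
    exact Probability.LatticeModels.besselI_pos hx _
  have hsq : 0 < besselI (n + 1) x ^ 2 := pow_pos hI 2
  constructor
  · rw [div_lt_div_iff₀ (by positivity) hsq]
    have h := mul_besselI_succ_sq_lt n hx.ne'
    nlinarith [h]
  · rw [div_lt_one hsq]
    exact besselI_mul_besselI_add_two_lt_sq n hx.ne'

/-- The case used by the lattice-gauge files: `2/3 < I₁(x) I₃(x) / I₂(x)² < 1` for `x > 0`
(`u = I₂/I₁` the SU(2) fundamental character ratio, `I₃/I₁` the adjoint one:
`(2/3)·u² < I₃/I₁ < u²`). [cite: Baricz2010TuranBessel, Theorem 2.1 (2.1) at ν = 2] -/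
theorem besselI_one_mul_three_div_two_sq_mem_Ioo {x : ℝ} (hx : 0 < x) :
    besselI 1 x * besselI 3 x / besselI 2 x ^ 2 ∈ Set.Ioo (2 / 3 : ℝ) 1 := by
  have h := besselI_mul_besselI_div_sq_mem_Ioo 1 hx
  norm_num at h
  exact h

end Literature.Analysis.FunctionSpaces
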